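import Mathlib
import HarnessLib
import Summits.HubbardSuperconductivity.HubbardSuperconductivity.Theorems.KLProgrammeC4aPartnerBandCrossings

/-!
# Route `KLProgramme` — crux C4a, S3 brick (B2, GENERIC CONFIGURATIONS — the SLOPES NEAR THE CROSSINGS): the angular slope of the partner band stays within
# `O(|e| + |φ − φ_c| + |ρ|)` of the level-0 transversality number of the crossing

Cell `gate-hubbard-kl`, lane hubbard-kl-c4a-1 (g6); helper for stub (C) `stub_twoLeg_curvature` of the engine-flow child `KLRegimeEngineV17F2`
(stmt-HubbardSuperconductivity-20437); memo HOME/hubbard-kl-c4a-1/C4A-PLAN.md §24.10 (a).  With `Γ = Φ(0,·)` and the level-0 transversality numbers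
`T_k(ϑ,θ) := −De_K(Γ(ϑ+θ))[Γ′(θ)]`, `T_q(ϑ,θ) := −De_K(Γ(θ))[Γ′(ϑ+θ)]` (they vanish exactly at the Cooper/forward and tangency configurations; a Gauss-map rate bounds them
below by `dist(ϑ, {0, π})` — (B2-trans) (b), not here), the angular slope `∂_φ ē` of the pp partner band at the loop point `(e, φ)` differs from `T_k` by
`≤ K₂D₁(|e|/d + D₁|φ| + |ρ|/d) + K₁(RR₁|e| + D₂|φ|)` and from `T_q` by the same with `|φ − ϑ|`; ph twins (slopes `+De_K(partner)[tangent]`, crossings `φ_c = 0` and `ϑ + π`).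
Tool: the 1-jet comparison `abs_jet_one_sub_le` `|Df(P)[u] − Df(Q)[v]| ≤ K₂‖P−Q‖‖u‖ + K₁‖u−v‖` + g5's radial rows and angular moduli.

* `abs_jet_one_sub_le`; **`abs_deriv_partnerBand_pp_angle_sub_Tk_le`**, **`abs_deriv_partnerBand_pp_angle_sub_Tq_le`**, **`abs_deriv_partnerBand_ph_angle_sub_Tk_le`**,
  **`abs_deriv_partnerBand_ph_angle_sub_Tnegq_le`**.

Pure bookkeeping on landed objects; nothing about the model's sizes; nothing asserts superconductivity.  References: FST II CPAM 51 (1998) §3; BGM 2006 §2.4 (2.40) [cite: BenfattoGiulianiMastropietro2006].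
-/

noncomputable section

namespace Summit.HubbardSuperconductivity.HubbardSuperconductivity.Theorems.C4a

set_option linter.dupNamespace false -- summit = problem name (single-conjunct summit), D-0017

open Real Set Filter
open scoped Topology
open Literature.MathematicalPhysics.QuantumLattice Literature.MathematicalPhysics.QuantumLattice.BandSectorCounting Literature.Probability.LatticeModels
open Summit.HubbardSuperconductivity.HubbardSuperconductivity.Theorems.KLRegimeSplit
open Summit.HubbardSuperconductivity.HubbardSuperconductivity.Theorems.DispersionFlow
open Summit.HubbardSuperconductivity.HubbardSuperconductivity.Theorems.PerturbedFermiCurve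

section Abstract

variable {V : Type*} [NormedAddCommGroup V] [NormedSpace ℝ V]

/-- **1-jet comparison**: `|Df(P)[u] − Df(Q)[v]| ≤ K₂‖P − Q‖‖u‖ + K₁‖u − v‖`. [folklore] -/
theorem abs_jet_one_sub_le {f : V → ℝ} (hf : ContDiff ℝ 2 f) {K₁ K₂ : ℝ} (hK₁ : ∀ x, ‖fderiv ℝ f x‖ ≤ K₁) (hK₂ : ∀ x, ‖iteratedFDeriv ℝ 2 f x‖ ≤ K₂) (P Q u v : V) :
    |fderiv ℝ f P u - fderiv ℝ f Q v| ≤ K₂ * ‖P - Q‖ * ‖u‖ + K₁ * ‖u - v‖ := by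
  have key : fderiv ℝ f P u - fderiv ℝ f Q v = (fderiv ℝ f P - fderiv ℝ f Q) u + fderiv ℝ f Q (u - v) := by
    simp only [map_sub, show ∀ (A B : V →L[ℝ] ℝ) (z : V), (A - B) z = A z - B z from fun _ _ _ => rfl]; ring
  rw [key]
  have hLip : ‖fderiv ℝ f P - fderiv ℝ f Q‖ ≤ K₂ * ‖P - Q‖ := by
    have hdiff : Differentiable ℝ (fderiv ℝ f) := (hf.fderiv_right (m := 1) (by norm_num)).differentiable one_ne_zero
    exact (convex_univ (𝕜 := ℝ) (E := V)).norm_image_sub_le_of_norm_fderiv_le (𝕜 := ℝ) (f := fderiv ℝ f) (fun z _ => hdiff z)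
      (fun z _ => by rw [norm_fderiv_two_eq_norm_iteratedFDeriv]; exact hK₂ z) (mem_univ Q) (mem_univ P)
  have t1 : |(fderiv ℝ f P - fderiv ℝ f Q) u| ≤ K₂ * ‖P - Q‖ * ‖u‖ := by
    rw [← Real.norm_eq_abs]; exact ((fderiv ℝ f P - fderiv ℝ f Q).le_opNorm u).trans (mul_le_mul_of_nonneg_right hLip (norm_nonneg _))
  have t2 : |fderiv ℝ f Q (u - v)| ≤ K₁ * ‖u - v‖ := by
    rw [← Real.norm_eq_abs]; exact ((fderiv ℝ f Q).le_opNorm _).trans (mul_le_mul_of_nonneg_right (hK₁ Q) (norm_nonneg _))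
  exact (abs_add_le _ _).trans (add_le_add t1 t2)

end Abstract

section Sizes

variable {K : TrigPolyC4v} {A : ℝ} (hA : ∀ p : Momentum, ∀ j ≤ 2, ‖iteratedFDeriv ℝ j (frameShift K) p‖ ≤ A) (hA20 : A ≤ 1 / 20)
  (hd : klCurveD ≤ (bandBounds (show (-4 : ℝ) < -1.1 by norm_num) (show (-1.1 : ℝ) ≤ -0.1 by norm_num)
    (show (-0.1 : ℝ) < 0 by norm_num)).Dtmin - 2 * A)
  {μ r : ℝ} (hr : 0 < r) (hlo : (-1.1 : ℝ) < μ - r - A) (hhi : μ + r + A < -0.1)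
  {A₃ A₄ : ℝ} (hA₃ : ∀ p : Momentum, ‖iteratedFDeriv ℝ 3 (frameShift K) p‖ ≤ A₃)
  (hA₄ : ∀ p : Momentum, ‖iteratedFDeriv ℝ 4 (frameShift K) p‖ ≤ A₄)
  {K₁ K₂ : ℝ} (hK₁ : ∀ p : Momentum, ‖fderiv ℝ (frameLevel μ K) p‖ ≤ K₁) (hK₂ : ∀ p : Momentum, ‖iteratedFDeriv ℝ 2 (frameLevel μ K) p‖ ≤ K₂)
include hA hA20 hd hr hlo hhi hA₃ hA₄ hK₁ hK₂

/-- **pp slope near the crossing `k`**: `|∂_φ ē(e,φ) − T_k| ≤ K₂D₁(|e|/d + D₁|φ| + |ρ|/d) + K₁(RR₁|e| + D₂|φ|)`, `T_k = −De_K(Γ(ϑ+θ))[Γ′(θ)]`. -/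
theorem abs_deriv_partnerBand_pp_angle_sub_Tk_le {ρ : ℝ} (hρ : |ρ| < r) {e : ℝ} (he : |e| < r) (ϑ θ φ : ℝ) :
    |deriv (fun ψ : ℝ => frameLevel μ K (pairSumPath μ K ρ ϑ θ 0 - levelPoint μ K e (ψ + θ))) φ -
        -(fderiv ℝ (frameLevel μ K) (levelPoint μ K 0 (ϑ + θ)) (iteratedDeriv 1 (levelPoint μ K 0) θ))| ≤
      K₂ * ((|e| / ((bandBounds (show (-4 : ℝ) < -1.1 by norm_num) (show (-1.1 : ℝ) ≤ -0.1 by norm_num) (show (-0.1 : ℝ) < 0 by norm_num)).Dtmin - 2 * A) + msD A₃ A₄ 1 * |φ|) + |ρ| / ((bandBounds (show (-4 : ℝ) < -1.1 by norm_num) (show (-1.1 : ℝ) ≤ -0.1 by norm_num) (show (-0.1 : ℝ) < 0 by norm_num)).Dtmin - 2 * A)) * msD A₃ A₄ 1 +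
        K₁ * (radialRowOneConst A ((bandBounds (show (-4 : ℝ) < -1.1 by norm_num) (show (-1.1 : ℝ) ≤ -0.1 by norm_num) (show (-0.1 : ℝ) < 0 by norm_num)).Dtmin - 2 * A) * |e| + msD A₃ A₄ 2 * |φ|) := by
  set B₀ := bandBounds (show (-4 : ℝ) < -1.1 by norm_num) (show (-1.1 : ℝ) ≤ -0.1 by norm_num) (show (-0.1 : ℝ) < 0 by norm_num) with hB₀
  have hADt : 2 * A < B₀.Dtmin := by have := klCurveD_pos; linarith
  have h0 : |(0 : ℝ)| < r := by simpa using hr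
  have hK₁0 : 0 ≤ K₁ := (norm_nonneg _).trans (hK₁ 0)
  have hK₂0 : 0 ≤ K₂ := (norm_nonneg _).trans (hK₂ 0)
  have hf2 : ContDiff ℝ 2 (frameLevel μ K) := EngineV8.contDiff_frameLevel μ K
  rw [(hasDerivAt_partnerBand_pp_angle hA hd hlo hhi (ρ := ρ) (ϑ := ϑ) (θ := θ) he φ).deriv,
    show -(fderiv ℝ (frameLevel μ K) (pairSumPath μ K ρ ϑ θ 0 - levelPoint μ K e (φ + θ)) (iteratedDeriv 1 (levelPoint μ K e) (φ + θ))) -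
        -(fderiv ℝ (frameLevel μ K) (levelPoint μ K 0 (ϑ + θ)) (iteratedDeriv 1 (levelPoint μ K 0) θ)) =
      -(fderiv ℝ (frameLevel μ K) (pairSumPath μ K ρ ϑ θ 0 - levelPoint μ K e (φ + θ)) (iteratedDeriv 1 (levelPoint μ K e) (φ + θ)) -
        fderiv ℝ (frameLevel μ K) (levelPoint μ K 0 (ϑ + θ)) (iteratedDeriv 1 (levelPoint μ K 0) θ)) by ring, abs_neg]
  refine (abs_jet_one_sub_le hf2 hK₁ hK₂ _ _ _ _).trans ?_
  -- the point displacement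
  have hP : ‖pairSumPath μ K ρ ϑ θ 0 - levelPoint μ K e (φ + θ) - levelPoint μ K 0 (ϑ + θ)‖ ≤ (|e| / (B₀.Dtmin - 2 * A) + msD A₃ A₄ 1 * |φ|) + |ρ| / (B₀.Dtmin - 2 * A) := by
    have e1 : pairSumPath μ K ρ ϑ θ 0 - levelPoint μ K e (φ + θ) - levelPoint μ K 0 (ϑ + θ) =
        ((levelPoint μ K 0 (φ + θ) - levelPoint μ K e (φ + θ)) + (levelPoint μ K 0 θ - levelPoint μ K 0 (φ + θ))) +
          (levelPoint μ K ρ (ϑ + θ) - levelPoint μ K 0 (ϑ + θ)) := by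
      simp only [pairSumPath, add_zero]; abel
    rw [e1]
    refine (norm_add_le _ _).trans (add_le_add ((norm_add_le _ _).trans (add_le_add ?_ ?_)) ?_)
    · have h := norm_levelPoint_sub_levelPoint_le B₀ hA hADt hlo hhi (ρ := 0) (ρ' := e) ⟨by linarith, hr⟩ ⟨(abs_lt.1 he).1, (abs_lt.1 he).2⟩ (φ + θ)
      rwa [zero_sub, abs_neg] at h
    · have h := norm_iteratedDeriv_levelPoint_sub_le_angle hA hA20 hd hlo hhi hA₃ hA₄ h0 (i := 0) (by norm_num) θ (φ + θ)
      rwa [iteratedDeriv_zero, show θ - (φ + θ) = -φ by ring, abs_neg] at h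
    · have h := norm_levelPoint_sub_levelPoint_le B₀ hA hADt hlo hhi (ρ := ρ) (ρ' := 0) ⟨(abs_lt.1 hρ).1, (abs_lt.1 hρ).2⟩ ⟨by linarith, hr⟩ (ϑ + θ)
      rwa [sub_zero] at h
  -- the tangent displacement
  have hU : ‖iteratedDeriv 1 (levelPoint μ K e) (φ + θ) - iteratedDeriv 1 (levelPoint μ K 0) θ‖ ≤ radialRowOneConst A ((bandBounds (show (-4 : ℝ) < -1.1 by norm_num) (show (-1.1 : ℝ) ≤ -0.1 by norm_num) (show (-0.1 : ℝ) < 0 by norm_num)).Dtmin - 2 * A) * |e| + msD A₃ A₄ 2 * |φ| := by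
    rw [show iteratedDeriv 1 (levelPoint μ K e) (φ + θ) - iteratedDeriv 1 (levelPoint μ K 0) θ =
      (iteratedDeriv 1 (levelPoint μ K e) (φ + θ) - iteratedDeriv 1 (levelPoint μ K 0) (φ + θ)) +
        (iteratedDeriv 1 (levelPoint μ K 0) (φ + θ) - iteratedDeriv 1 (levelPoint μ K 0) θ) by abel]
    refine (norm_add_le _ _).trans (add_le_add (norm_iteratedDeriv_one_levelPoint_sub_le hA hd hr hlo hhi he (φ + θ)) ?_)
    have h := norm_iteratedDeriv_levelPoint_sub_le_angle hA hA20 hd hlo hhi hA₃ hA₄ h0 (i := 1) (by norm_num) (φ + θ) θ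
    rwa [show φ + θ - θ = φ by ring] at h
  have hu : ‖iteratedDeriv 1 (levelPoint μ K e) (φ + θ)‖ ≤ msD A₃ A₄ 1 := norm_iteratedDeriv_levelPoint_le hA hA20 hd hlo hhi hA₃ hA₄ he le_rfl (by norm_num) _
  have hP0 : 0 ≤ K₂ * ((|e| / (B₀.Dtmin - 2 * A) + msD A₃ A₄ 1 * |φ|) + |ρ| / (B₀.Dtmin - 2 * A)) := mul_nonneg hK₂0 ((norm_nonneg _).trans hP)
  gcongr

/-- **pp slope near the crossing `q′`**: `|∂_φ ē(e,φ) − T_q| ≤ K₂D₁(|e|/d + D₁|φ − ϑ| + |ρ|/d) + K₁(RR₁|e| + D₂|φ − ϑ|)`, `T_q = −De_K(Γ(θ))[Γ′(ϑ+θ)]`. -/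
theorem abs_deriv_partnerBand_pp_angle_sub_Tq_le {ρ : ℝ} (hρ : |ρ| < r) {e : ℝ} (he : |e| < r) (ϑ θ φ : ℝ) :
    |deriv (fun ψ : ℝ => frameLevel μ K (pairSumPath μ K ρ ϑ θ 0 - levelPoint μ K e (ψ + θ))) φ -
        -(fderiv ℝ (frameLevel μ K) (levelPoint μ K 0 θ) (iteratedDeriv 1 (levelPoint μ K 0) (ϑ + θ)))| ≤
      K₂ * ((|e| / ((bandBounds (show (-4 : ℝ) < -1.1 by norm_num) (show (-1.1 : ℝ) ≤ -0.1 by norm_num) (show (-0.1 : ℝ) < 0 by norm_num)).Dtmin - 2 * A) + msD A₃ A₄ 1 * |φ - ϑ|) + |ρ| / ((bandBounds (show (-4 : ℝ) < -1.1 by norm_num) (show (-1.1 : ℝ) ≤ -0.1 by norm_num) (show (-0.1 : ℝ) < 0 by norm_num)).Dtmin - 2 * A)) * msD A₃ A₄ 1 +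
        K₁ * (radialRowOneConst A ((bandBounds (show (-4 : ℝ) < -1.1 by norm_num) (show (-1.1 : ℝ) ≤ -0.1 by norm_num) (show (-0.1 : ℝ) < 0 by norm_num)).Dtmin - 2 * A) * |e| + msD A₃ A₄ 2 * |φ - ϑ|) := by
  set B₀ := bandBounds (show (-4 : ℝ) < -1.1 by norm_num) (show (-1.1 : ℝ) ≤ -0.1 by norm_num) (show (-0.1 : ℝ) < 0 by norm_num) with hB₀
  have hADt : 2 * A < B₀.Dtmin := by have := klCurveD_pos; linarith
  have h0 : |(0 : ℝ)| < r := by simpa using hr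
  have hK₁0 : 0 ≤ K₁ := (norm_nonneg _).trans (hK₁ 0)
  have hK₂0 : 0 ≤ K₂ := (norm_nonneg _).trans (hK₂ 0)
  have hf2 : ContDiff ℝ 2 (frameLevel μ K) := EngineV8.contDiff_frameLevel μ K
  rw [(hasDerivAt_partnerBand_pp_angle hA hd hlo hhi (ρ := ρ) (ϑ := ϑ) (θ := θ) he φ).deriv,
    show -(fderiv ℝ (frameLevel μ K) (pairSumPath μ K ρ ϑ θ 0 - levelPoint μ K e (φ + θ)) (iteratedDeriv 1 (levelPoint μ K e) (φ + θ))) -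
        -(fderiv ℝ (frameLevel μ K) (levelPoint μ K 0 θ) (iteratedDeriv 1 (levelPoint μ K 0) (ϑ + θ))) =
      -(fderiv ℝ (frameLevel μ K) (pairSumPath μ K ρ ϑ θ 0 - levelPoint μ K e (φ + θ)) (iteratedDeriv 1 (levelPoint μ K e) (φ + θ)) -
        fderiv ℝ (frameLevel μ K) (levelPoint μ K 0 θ) (iteratedDeriv 1 (levelPoint μ K 0) (ϑ + θ))) by ring, abs_neg]
  refine (abs_jet_one_sub_le hf2 hK₁ hK₂ _ _ _ _).trans ?_
  have hP : ‖pairSumPath μ K ρ ϑ θ 0 - levelPoint μ K e (φ + θ) - levelPoint μ K 0 θ‖ ≤ (|e| / (B₀.Dtmin - 2 * A) + msD A₃ A₄ 1 * |φ - ϑ|) + |ρ| / (B₀.Dtmin - 2 * A) := by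
    have e1 : pairSumPath μ K ρ ϑ θ 0 - levelPoint μ K e (φ + θ) - levelPoint μ K 0 θ =
        ((levelPoint μ K 0 (φ + θ) - levelPoint μ K e (φ + θ)) + (levelPoint μ K 0 (ϑ + θ) - levelPoint μ K 0 (φ + θ))) +
          (levelPoint μ K ρ (ϑ + θ) - levelPoint μ K 0 (ϑ + θ)) := by
      simp only [pairSumPath, add_zero]; abel
    rw [e1]
    refine (norm_add_le _ _).trans (add_le_add ((norm_add_le _ _).trans (add_le_add ?_ ?_)) ?_)
    · have h := norm_levelPoint_sub_levelPoint_le B₀ hA hADt hlo hhi (ρ := 0) (ρ' := e) ⟨by linarith, hr⟩ ⟨(abs_lt.1 he).1, (abs_lt.1 he).2⟩ (φ + θ)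
      rwa [zero_sub, abs_neg] at h
    · have h := norm_iteratedDeriv_levelPoint_sub_le_angle hA hA20 hd hlo hhi hA₃ hA₄ h0 (i := 0) (by norm_num) (ϑ + θ) (φ + θ)
      rwa [iteratedDeriv_zero, show ϑ + θ - (φ + θ) = -(φ - ϑ) by ring, abs_neg] at h
    · have h := norm_levelPoint_sub_levelPoint_le B₀ hA hADt hlo hhi (ρ := ρ) (ρ' := 0) ⟨(abs_lt.1 hρ).1, (abs_lt.1 hρ).2⟩ ⟨by linarith, hr⟩ (ϑ + θ)
      rwa [sub_zero] at h
  have hU : ‖iteratedDeriv 1 (levelPoint μ K e) (φ + θ) - iteratedDeriv 1 (levelPoint μ K 0) (ϑ + θ)‖ ≤ radialRowOneConst A ((bandBounds (show (-4 : ℝ) < -1.1 by norm_num) (show (-1.1 : ℝ) ≤ -0.1 by norm_num) (show (-0.1 : ℝ) < 0 by norm_num)).Dtmin - 2 * A) * |e| + msD A₃ A₄ 2 * |φ - ϑ| := by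
    rw [show iteratedDeriv 1 (levelPoint μ K e) (φ + θ) - iteratedDeriv 1 (levelPoint μ K 0) (ϑ + θ) =
      (iteratedDeriv 1 (levelPoint μ K e) (φ + θ) - iteratedDeriv 1 (levelPoint μ K 0) (φ + θ)) +
        (iteratedDeriv 1 (levelPoint μ K 0) (φ + θ) - iteratedDeriv 1 (levelPoint μ K 0) (ϑ + θ)) by abel]
    refine (norm_add_le _ _).trans (add_le_add (norm_iteratedDeriv_one_levelPoint_sub_le hA hd hr hlo hhi he (φ + θ)) ?_)
    have h := norm_iteratedDeriv_levelPoint_sub_le_angle hA hA20 hd hlo hhi hA₃ hA₄ h0 (i := 1) (by norm_num) (φ + θ) (ϑ + θ)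
    rwa [show φ + θ - (ϑ + θ) = φ - ϑ by ring] at h
  have hu : ‖iteratedDeriv 1 (levelPoint μ K e) (φ + θ)‖ ≤ msD A₃ A₄ 1 := norm_iteratedDeriv_levelPoint_le hA hA20 hd hlo hhi hA₃ hA₄ he le_rfl (by norm_num) _
  have hP0 : 0 ≤ K₂ * ((|e| / (B₀.Dtmin - 2 * A) + msD A₃ A₄ 1 * |φ - ϑ|) + |ρ| / (B₀.Dtmin - 2 * A)) := mul_nonneg hK₂0 ((norm_nonneg _).trans hP)
  gcongr

/-- **ph slope near the crossing `k`**: `|∂_φ ē(e,φ) − T′_k| ≤ K₂D₁(|e|/d + D₁|φ| + |ρ|/d) + K₁(RR₁|e| + D₂|φ|)`, `T′_k = +De_K(Γ(ϑ+θ))[Γ′(θ)]`. -/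
theorem abs_deriv_partnerBand_ph_angle_sub_Tk_le {ρ : ℝ} (hρ : |ρ| < r) {e : ℝ} (he : |e| < r) (ϑ θ φ : ℝ) :
    |deriv (fun ψ : ℝ => frameLevel μ K (levelPoint μ K e (ψ + θ) - pairDiffPath μ K ρ ϑ θ 0)) φ -
        fderiv ℝ (frameLevel μ K) (levelPoint μ K 0 (ϑ + θ)) (iteratedDeriv 1 (levelPoint μ K 0) θ)| ≤
      K₂ * ((|e| / ((bandBounds (show (-4 : ℝ) < -1.1 by norm_num) (show (-1.1 : ℝ) ≤ -0.1 by norm_num) (show (-0.1 : ℝ) < 0 by norm_num)).Dtmin - 2 * A) + msD A₃ A₄ 1 * |φ|) + |ρ| / ((bandBounds (show (-4 : ℝ) < -1.1 by norm_num) (show (-1.1 : ℝ) ≤ -0.1 by norm_num) (show (-0.1 : ℝ) < 0 by norm_num)).Dtmin - 2 * A)) * msD A₃ A₄ 1 +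
        K₁ * (radialRowOneConst A ((bandBounds (show (-4 : ℝ) < -1.1 by norm_num) (show (-1.1 : ℝ) ≤ -0.1 by norm_num) (show (-0.1 : ℝ) < 0 by norm_num)).Dtmin - 2 * A) * |e| + msD A₃ A₄ 2 * |φ|) := by
  set B₀ := bandBounds (show (-4 : ℝ) < -1.1 by norm_num) (show (-1.1 : ℝ) ≤ -0.1 by norm_num) (show (-0.1 : ℝ) < 0 by norm_num) with hB₀
  have hADt : 2 * A < B₀.Dtmin := by have := klCurveD_pos; linarith
  have h0 : |(0 : ℝ)| < r := by simpa using hr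
  have hK₁0 : 0 ≤ K₁ := (norm_nonneg _).trans (hK₁ 0)
  have hK₂0 : 0 ≤ K₂ := (norm_nonneg _).trans (hK₂ 0)
  have hf2 : ContDiff ℝ 2 (frameLevel μ K) := EngineV8.contDiff_frameLevel μ K
  rw [(hasDerivAt_partnerBand_ph_angle hA hd hlo hhi (ρ := ρ) (ϑ := ϑ) (θ := θ) he φ).deriv]
  refine (abs_jet_one_sub_le hf2 hK₁ hK₂ _ _ _ _).trans ?_
  have hP : ‖levelPoint μ K e (φ + θ) - pairDiffPath μ K ρ ϑ θ 0 - levelPoint μ K 0 (ϑ + θ)‖ ≤ (|e| / (B₀.Dtmin - 2 * A) + msD A₃ A₄ 1 * |φ|) + |ρ| / (B₀.Dtmin - 2 * A) := by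
    have e1 : levelPoint μ K e (φ + θ) - pairDiffPath μ K ρ ϑ θ 0 - levelPoint μ K 0 (ϑ + θ) =
        ((levelPoint μ K e (φ + θ) - levelPoint μ K 0 (φ + θ)) + (levelPoint μ K 0 (φ + θ) - levelPoint μ K 0 θ)) +
          (levelPoint μ K ρ (ϑ + θ) - levelPoint μ K 0 (ϑ + θ)) := by
      simp only [pairDiffPath, add_zero]; abel
    rw [e1]
    refine (norm_add_le _ _).trans (add_le_add ((norm_add_le _ _).trans (add_le_add ?_ ?_)) ?_)
    · have h := norm_levelPoint_sub_levelPoint_le B₀ hA hADt hlo hhi (ρ := e) (ρ' := 0) ⟨(abs_lt.1 he).1, (abs_lt.1 he).2⟩ ⟨by linarith, hr⟩ (φ + θ)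
      rwa [sub_zero] at h
    · have h := norm_iteratedDeriv_levelPoint_sub_le_angle hA hA20 hd hlo hhi hA₃ hA₄ h0 (i := 0) (by norm_num) (φ + θ) θ
      rwa [iteratedDeriv_zero, show φ + θ - θ = φ by ring] at h
    · have h := norm_levelPoint_sub_levelPoint_le B₀ hA hADt hlo hhi (ρ := ρ) (ρ' := 0) ⟨(abs_lt.1 hρ).1, (abs_lt.1 hρ).2⟩ ⟨by linarith, hr⟩ (ϑ + θ)
      rwa [sub_zero] at h
  have hU : ‖iteratedDeriv 1 (levelPoint μ K e) (φ + θ) - iteratedDeriv 1 (levelPoint μ K 0) θ‖ ≤ radialRowOneConst A ((bandBounds (show (-4 : ℝ) < -1.1 by norm_num) (show (-1.1 : ℝ) ≤ -0.1 by norm_num) (show (-0.1 : ℝ) < 0 by norm_num)).Dtmin - 2 * A) * |e| + msD A₃ A₄ 2 * |φ| := by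
    rw [show iteratedDeriv 1 (levelPoint μ K e) (φ + θ) - iteratedDeriv 1 (levelPoint μ K 0) θ =
      (iteratedDeriv 1 (levelPoint μ K e) (φ + θ) - iteratedDeriv 1 (levelPoint μ K 0) (φ + θ)) +
        (iteratedDeriv 1 (levelPoint μ K 0) (φ + θ) - iteratedDeriv 1 (levelPoint μ K 0) θ) by abel]
    refine (norm_add_le _ _).trans (add_le_add (norm_iteratedDeriv_one_levelPoint_sub_le hA hd hr hlo hhi he (φ + θ)) ?_)
    have h := norm_iteratedDeriv_levelPoint_sub_le_angle hA hA20 hd hlo hhi hA₃ hA₄ h0 (i := 1) (by norm_num) (φ + θ) θ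
    rwa [show φ + θ - θ = φ by ring] at h
  have hu : ‖iteratedDeriv 1 (levelPoint μ K e) (φ + θ)‖ ≤ msD A₃ A₄ 1 := norm_iteratedDeriv_levelPoint_le hA hA20 hd hlo hhi hA₃ hA₄ he le_rfl (by norm_num) _
  have hP0 : 0 ≤ K₂ * ((|e| / (B₀.Dtmin - 2 * A) + msD A₃ A₄ 1 * |φ|) + |ρ| / (B₀.Dtmin - 2 * A)) := mul_nonneg hK₂0 ((norm_nonneg _).trans hP)
  gcongr

/-- **ph slope near the crossing `−q′`**: `|∂_φ ē(e,φ) − T′_{−q}| ≤ K₂D₁(|e|/d + D₁|φ − (ϑ+π)| + |ρ|/d) + K₁(RR₁|e| + D₂|φ − (ϑ+π)|)`,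
`T′_{−q} = De_K(−Γ(θ))[−Γ′(ϑ+θ)]`. -/
theorem abs_deriv_partnerBand_ph_angle_sub_Tnegq_le {ρ : ℝ} (hρ : |ρ| < r) {e : ℝ} (he : |e| < r) (ϑ θ φ : ℝ) :
    |deriv (fun ψ : ℝ => frameLevel μ K (levelPoint μ K e (ψ + θ) - pairDiffPath μ K ρ ϑ θ 0)) φ -
        fderiv ℝ (frameLevel μ K) (-levelPoint μ K 0 θ) (-iteratedDeriv 1 (levelPoint μ K 0) (ϑ + θ))| ≤
      K₂ * ((|e| / ((bandBounds (show (-4 : ℝ) < -1.1 by norm_num) (show (-1.1 : ℝ) ≤ -0.1 by norm_num) (show (-0.1 : ℝ) < 0 by norm_num)).Dtmin - 2 * A) + msD A₃ A₄ 1 * |φ - (ϑ + π)|) + |ρ| / ((bandBounds (show (-4 : ℝ) < -1.1 by norm_num) (show (-1.1 : ℝ) ≤ -0.1 by norm_num) (show (-0.1 : ℝ) < 0 by norm_num)).Dtmin - 2 * A)) * msD A₃ A₄ 1 +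
        K₁ * (radialRowOneConst A ((bandBounds (show (-4 : ℝ) < -1.1 by norm_num) (show (-1.1 : ℝ) ≤ -0.1 by norm_num) (show (-0.1 : ℝ) < 0 by norm_num)).Dtmin - 2 * A) * |e| + msD A₃ A₄ 2 * |φ - (ϑ + π)|) := by
  set B₀ := bandBounds (show (-4 : ℝ) < -1.1 by norm_num) (show (-1.1 : ℝ) ≤ -0.1 by norm_num) (show (-0.1 : ℝ) < 0 by norm_num) with hB₀
  have hADt : 2 * A < B₀.Dtmin := by have := klCurveD_pos; linarith
  have h0 : |(0 : ℝ)| < r := by simpa using hr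
  have hK₁0 : 0 ≤ K₁ := (norm_nonneg _).trans (hK₁ 0)
  have hK₂0 : 0 ≤ K₂ := (norm_nonneg _).trans (hK₂ 0)
  have hf2 : ContDiff ℝ 2 (frameLevel μ K) := EngineV8.contDiff_frameLevel μ K
  rw [(hasDerivAt_partnerBand_ph_angle hA hd hlo hhi (ρ := ρ) (ϑ := ϑ) (θ := θ) he φ).deriv]
  refine (abs_jet_one_sub_le hf2 hK₁ hK₂ _ _ _ _).trans ?_
  have hP : ‖levelPoint μ K e (φ + θ) - pairDiffPath μ K ρ ϑ θ 0 - -levelPoint μ K 0 θ‖ ≤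
      (|e| / (B₀.Dtmin - 2 * A) + msD A₃ A₄ 1 * |φ - (ϑ + π)|) + |ρ| / (B₀.Dtmin - 2 * A) := by
    have e1 : levelPoint μ K e (φ + θ) - pairDiffPath μ K ρ ϑ θ 0 - -levelPoint μ K 0 θ =
        ((levelPoint μ K e (φ + θ) - levelPoint μ K 0 (φ + θ)) + (levelPoint μ K 0 (φ + θ) - levelPoint μ K 0 (ϑ + π + θ))) +
          (levelPoint μ K ρ (ϑ + θ) - levelPoint μ K 0 (ϑ + θ)) := by
      rw [show ϑ + π + θ = (ϑ + θ) + π by ring, levelPoint_add_pi]; simp only [pairDiffPath, add_zero]; abel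
    rw [e1]
    refine (norm_add_le _ _).trans (add_le_add ((norm_add_le _ _).trans (add_le_add ?_ ?_)) ?_)
    · have h := norm_levelPoint_sub_levelPoint_le B₀ hA hADt hlo hhi (ρ := e) (ρ' := 0) ⟨(abs_lt.1 he).1, (abs_lt.1 he).2⟩ ⟨by linarith, hr⟩ (φ + θ)
      rwa [sub_zero] at h
    · have h := norm_iteratedDeriv_levelPoint_sub_le_angle hA hA20 hd hlo hhi hA₃ hA₄ h0 (i := 0) (by norm_num) (φ + θ) (ϑ + π + θ)
      rwa [iteratedDeriv_zero, show φ + θ - (ϑ + π + θ) = φ - (ϑ + π) by ring] at h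
    · have h := norm_levelPoint_sub_levelPoint_le B₀ hA hADt hlo hhi (ρ := ρ) (ρ' := 0) ⟨(abs_lt.1 hρ).1, (abs_lt.1 hρ).2⟩ ⟨by linarith, hr⟩ (ϑ + θ)
      rwa [sub_zero] at h
  have hU : ‖iteratedDeriv 1 (levelPoint μ K e) (φ + θ) - -iteratedDeriv 1 (levelPoint μ K 0) (ϑ + θ)‖ ≤ radialRowOneConst A ((bandBounds (show (-4 : ℝ) < -1.1 by norm_num) (show (-1.1 : ℝ) ≤ -0.1 by norm_num) (show (-0.1 : ℝ) < 0 by norm_num)).Dtmin - 2 * A) * |e| + msD A₃ A₄ 2 * |φ - (ϑ + π)| := by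
    rw [show -iteratedDeriv 1 (levelPoint μ K 0) (ϑ + θ) = iteratedDeriv 1 (levelPoint μ K 0) (ϑ + π + θ) by
        rw [show ϑ + π + θ = (ϑ + θ) + π by ring, iteratedDeriv_levelPoint_add_pi],
      show iteratedDeriv 1 (levelPoint μ K e) (φ + θ) - iteratedDeriv 1 (levelPoint μ K 0) (ϑ + π + θ) =
      (iteratedDeriv 1 (levelPoint μ K e) (φ + θ) - iteratedDeriv 1 (levelPoint μ K 0) (φ + θ)) +
        (iteratedDeriv 1 (levelPoint μ K 0) (φ + θ) - iteratedDeriv 1 (levelPoint μ K 0) (ϑ + π + θ)) by abel]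
    refine (norm_add_le _ _).trans (add_le_add (norm_iteratedDeriv_one_levelPoint_sub_le hA hd hr hlo hhi he (φ + θ)) ?_)
    have h := norm_iteratedDeriv_levelPoint_sub_le_angle hA hA20 hd hlo hhi hA₃ hA₄ h0 (i := 1) (by norm_num) (φ + θ) (ϑ + π + θ)
    rwa [show φ + θ - (ϑ + π + θ) = φ - (ϑ + π) by ring] at h
  have hu : ‖iteratedDeriv 1 (levelPoint μ K e) (φ + θ)‖ ≤ msD A₃ A₄ 1 := norm_iteratedDeriv_levelPoint_le hA hA20 hd hlo hhi hA₃ hA₄ he le_rfl (by norm_num) _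
  have hP0 : 0 ≤ K₂ * ((|e| / (B₀.Dtmin - 2 * A) + msD A₃ A₄ 1 * |φ - (ϑ + π)|) + |ρ| / (B₀.Dtmin - 2 * A)) := mul_nonneg hK₂0 ((norm_nonneg _).trans hP)
  gcongr

end Sizes

end Summit.HubbardSuperconductivity.HubbardSuperconductivity.Theorems.C4a

end
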